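import Summits.MatrixMultiplication.MatrixMultiplication.Theorems.SoloInformedTwistedMatchingsEffective
import HarnessLib

/-!
# Effective Theorem B″ for abelian `p`-groups of bounded exponent `p^E`

Solo-informed seat (MatrixMultiplication), gen 101; sharpest-statement §2y(8), effective form beyond `𝔽_p^k`.
The slice-rank count behind `exists_abelianTwistedMatching_card_le` runs over digit vectors
`e : ιA → {0,…,p-1}` weighted by `W_a = (p+1)^{lvl a}`, `lvl a < E`, with `|S| = p^{|ιA|}`. Bounding both
tails by generating functions coordinate-by-coordinate gives the PARAMETRIC EFFECTIVE BOUND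
`twistedMatching_card_le_effective_primePow`: if `0 < u ≤ 1`, `c : ℝ` and for every level `s < E`
`u^{-(p-1)(p+1)^s/3} · Σ_{j<p} u^{j (p+1)^s} ≤ p^c`, then every twisted matching (any finite family of
automorphism-pair twists) in a finite abelian `S` with `g^{p^E} = 1` has `|ι| ≤ 3 |S|^c`.
Corollary `twistedMatching_card_le_exp_four`: exponent-`4` hosts (`p = 2`, `E = 2`, `u = 3/4`):
`|ι| ≤ 3 |S|^{19/20}` (`θ_2(3/4) = (4/3)^{1/3}·7/4 = 1.9261 ≤ 2^{0.95}`, `θ_2(27/64) = 91/48 ≤ 2^{0.95}`).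
References: BCCGNSU17 (arXiv:1605.06702) §4; Petrov 2016 / BCCGNSU17 for `ℤ/4^n`-type bounds.
-/

noncomputable section

open scoped BigOperators
open Finset Literature.Combinatorics.Additive Literature.Barriers.MatrixMultiplication

namespace Summit.MatrixMultiplication.MatrixMultiplication.Theorems.TwistedSliceRank

section EffectivePrimePow

/-- Weighted generating function: `Σ_e u^{c + ε Σ_a e_a W_a} = u^c Π_a Σ_{j<p} u^{ε j W_a}`. [folklore] -/
theorem sum_rpow_weighted {ι : Type*} [Fintype ι] [DecidableEq ι] (p : ℕ) (u : ℝ) (hu : 0 < u)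
    (c ε : ℝ) (W : ι → ℝ) :
    ∑ e : ι → Fin p, u ^ (c + ε * ∑ a, ((e a : ℕ) : ℝ) * W a) =
      u ^ c * ∏ a, ∑ j : Fin p, u ^ (ε * ((j : ℕ) : ℝ) * W a) := by
  have h1 : ∀ e : ι → Fin p, u ^ (c + ε * ∑ a, ((e a : ℕ) : ℝ) * W a) =
      u ^ c * ∏ a, u ^ (ε * ((e a : ℕ) : ℝ) * W a) := by
    intro e
    rw [Real.rpow_add hu, Finset.mul_sum, Real.rpow_sum_of_pos hu]
    simp_rw [mul_assoc]
  simp_rw [h1]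
  rw [← Finset.mul_sum]
  congr 1
  rw [Finset.prod_univ_sum (fun _ : ι => (Finset.univ : Finset (Fin p)))
      (fun a j => u ^ (ε * ((j : ℕ) : ℝ) * W a)), Fintype.piFinset_univ]

/-- Weighted reversal: `Σ_{j<p} u^{-j w} = u^{-(p-1) w} Σ_{j<p} u^{j w}`. [folklore] -/
theorem sum_rpow_neg_weighted (p : ℕ) (u : ℝ) (hu : 0 < u) (w : ℝ) :
    ∑ j : Fin p, u ^ (-1 * ((j : ℕ) : ℝ) * w) =
      u ^ (-(((p - 1 : ℕ) : ℝ)) * w) * ∑ j : Fin p, u ^ (((j : ℕ) : ℝ) * w) := by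
  rw [Finset.mul_sum,
    ← Equiv.sum_comp Fin.revPerm (fun j : Fin p => u ^ (-1 * ((j : ℕ) : ℝ) * w))]
  refine Finset.sum_congr rfl fun j _ => ?_
  rw [Fin.revPerm_apply, Fin.val_rev, ← Real.rpow_add hu]
  congr 1
  have hj : (j : ℕ) + 1 ≤ p := j.2
  have h1 : ((p - ((j : ℕ) + 1) : ℕ) : ℝ) = (p : ℝ) - ((j : ℕ) + 1) := by
    rw [Nat.cast_sub hj]; push_cast; ring
  have h2 : (((p - 1 : ℕ)) : ℝ) = (p : ℝ) - 1 := by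
    rw [Nat.cast_sub (by omega)]; push_cast; ring
  rw [h1, h2]; ring

/-- **Parametric effective B″ for exponent `p^E`.** If `0 < u ≤ 1` and every level `s < E` satisfies
`u^{-(p-1)(p+1)^s/3} Σ_{j<p} u^{j(p+1)^s} ≤ p^c`, then twisted matchings in finite abelian groups of
exponent dividing `p^E` have `|ι| ≤ 3 |S|^c`, whatever the automorphism-pair twists. [this work] -/
theorem twistedMatching_card_le_effective_primePow (p : ℕ) [hp : Fact p.Prime] (E : ℕ) (u c : ℝ)
    (hu0 : 0 < u) (hu1 : u ≤ 1)
    (hθ : ∀ s : ℕ, s < E →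
      u ^ (-(((p - 1 : ℕ) : ℝ)) * ((p : ℝ) + 1) ^ s / 3) *
        ∑ j : Fin p, u ^ (((j : ℕ) : ℝ) * ((p : ℝ) + 1) ^ s) ≤ (p : ℝ) ^ c)
    (S : Type) [CommGroup S] [Fintype S] [DecidableEq S] (hexpS : ∀ g : S, g ^ p ^ E = 1)
    (σ : Type) [Fintype σ] (φ ψ : σ → S ≃* S) (ι : Type) [Fintype ι] (x y z : ι → S)
    (hmatch : ∀ i j l : ι, (∃ s : σ, x i * φ s (y j) * ψ s (z l) = 1) ↔ (i = j ∧ j = l)) :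
    (Fintype.card ι : ℝ) ≤ 3 * (Fintype.card S : ℝ) ^ c := by
  classical
  have hp2 : 2 ≤ p := hp.out.two_le
  have hp0 : (0 : ℝ) < p := by exact_mod_cast hp.out.pos
  -- structure theorem: `S ≃* ∏_i ℤ/n_i`, `n_i = p^{e_i}`, `e_i ≤ E`
  obtain ⟨κ, _, nn, hn1, ⟨eS⟩⟩ := CommGroup.equiv_prod_multiplicative_zmod_of_finite S
  haveI : ∀ i, NeZero (nn i) := fun i => ⟨by have := hn1 i; omega⟩
  have hex : ∀ i, ∃ m ≤ E, nn i = p ^ m := by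
    intro i
    refine (Nat.dvd_prime_pow hp.out).1 ((ZMod.natCast_eq_zero_iff _ _).1 ?_)
    have h1 := hexpS (eS.symm (Pi.mulSingle i (Multiplicative.ofAdd (1 : ZMod (nn i)))))
    rw [← map_pow, eS.symm.map_eq_one_iff, ← Pi.mulSingle_pow, ← ofAdd_nsmul, nsmul_eq_mul,
      mul_one] at h1
    have h2 := congr_fun h1 i
    rw [Pi.mulSingle_eq_same, Pi.one_apply, ofAdd_eq_one] at h2
    exact h2
  choose e heE hne using hex
  obtain ⟨ιA, _, _, C, hCL, hS'⟩ := exists_prodZMod_levelPCGS (p := p) (n := nn) (e := e) hne heE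
  -- transport the matching along `eS`
  let φ' := fun s => (eS.symm.trans (φ s)).trans eS
  let ψ' := fun s => (eS.symm.trans (ψ s)).trans eS
  have hrel : ∀ (i j l : ι) (s : σ),
      eS (x i) * φ' s (eS (y j)) * ψ' s (eS (z l)) = 1 ↔ x i * φ s (y j) * ψ s (z l) = 1 := by
    intro i j l s
    simp only [φ', ψ', MulEquiv.trans_apply, MulEquiv.symm_apply_apply]
    rw [← map_mul, ← map_mul, eS.map_eq_one_iff]
  have hmatch' : ∀ i j l : ι,
      (∃ s : σ, eS (x i) * φ' s (eS (y j)) * ψ' s (eS (z l)) = 1) ↔ (i = j ∧ j = l) := by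
    intro i j l
    simp_rw [hrel]
    exact hmatch i j l
  -- the field and the weights
  have hinj : Function.Injective
      (algebraMap (Polynomial (ZMod p)) (FractionRing (Polynomial (ZMod p)))) :=
    IsFractionRing.injective (Polynomial (ZMod p)) (FractionRing (Polynomial (ZMod p)))
  haveI : CharP (FractionRing (Polynomial (ZMod p))) p := charP_of_injective_algebraMap hinj p
  haveI : Infinite (FractionRing (Polynomial (ZMod p))) := Infinite.of_injective _ hinj
  let Sol : ι → Finset σ := fun i => Finset.univ.filter fun s =>
    eS (x i) * φ' s (eS (y i)) * ψ' s (eS (z i)) = 1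
  have hSol : ∀ i, (Sol i).Nonempty := fun i => by
    obtain ⟨s, hs⟩ := (hmatch' i i i).2 ⟨rfl, rfl⟩
    exact ⟨s, by simp [Sol, hs]⟩
  obtain ⟨t, ht⟩ := exists_weights (K := FractionRing (Polynomial (ZMod p))) Sol hSol
  have hdiag : ∀ i, (∑ s, t s * (if eS (x i) * φ' s (eS (y i)) * ψ' s (eS (z i)) = 1
      then (1 : FractionRing (Polynomial (ZMod p))) else 0)) ≠ 0 := by
    intro i
    have hsum : (∑ s, t s * (if eS (x i) * φ' s (eS (y i)) * ψ' s (eS (z i)) = 1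
        then (1 : FractionRing (Polynomial (ZMod p))) else 0)) = ∑ s ∈ Sol i, t s := by
      rw [Finset.sum_filter]
      exact Finset.sum_congr rfl fun s _ => by split_ifs <;> simp
    rw [hsum]
    exact ht i
  -- total weight `D = (p-1) Σ_a W_a`, threshold `tt = ⌈D/3⌉`
  set D : ℕ := (p - 1) * ∑ a, C.W a with hD
  set tt : ℕ := (D + 2) / 3 with htt
  have hcard := card_le_of_levelTwistedMatching C (K := FractionRing (Polynomial (ZMod p))) hS' t
    φ' ψ' (fun i => eS (x i)) (fun i => eS (y i)) (fun i => eS (z i))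
    (fun i j l s h => (hmatch' i j l).1 ⟨s, h⟩) hdiag tt tt
  have hcard' : (Fintype.card ι : ℝ) ≤
      (Fintype.card {ex : ιA → Fin p // ∑ a, (ex a : ℕ) * C.W a < tt} : ℝ) +
      (Fintype.card {ex : ιA → Fin p // ∑ a, (ex a : ℕ) * C.W a < tt} : ℝ) +
      (Fintype.card {ex : ιA → Fin p // tt + tt ≤ ∑ a, (ex a : ℕ) * C.W a} : ℝ) := by
    exact_mod_cast hcard
  have hdegle : ∀ ex : ιA → Fin p, ∑ a, (ex a : ℕ) * C.W a ≤ D := by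
    intro ex
    rw [hD, Finset.mul_sum]
    exact Finset.sum_le_sum fun a _ => Nat.mul_le_mul_right _ (by have := (ex a).2; omega)
  -- the weights as reals
  let Wr : ιA → ℝ := fun a => ((C.W a : ℕ) : ℝ)
  have hWr : ∀ a, Wr a = ((p : ℝ) + 1) ^ C.lvl a := by
    intro a
    show (((p + 1) ^ C.lvl a : ℕ) : ℝ) = _
    push_cast; ring
  have hDr : (D : ℝ) = ((p - 1 : ℕ) : ℝ) * ∑ a, Wr a := by
    rw [hD]; push_cast; rfl
  -- the per-coordinate factor and its bound
  let F : ιA → ℝ := fun a =>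
    u ^ (-(((p - 1 : ℕ) : ℝ)) * Wr a / 3) * ∑ j : Fin p, u ^ (((j : ℕ) : ℝ) * Wr a)
  have hF : ∀ a, F a ≤ (p : ℝ) ^ c := by
    intro a
    have h1 := hθ (C.lvl a) (by rw [← hCL]; exact C.lvl_lt a)
    simp only [F, hWr]
    exact h1
  have hF0 : ∀ a, 0 ≤ F a := fun a =>
    mul_nonneg (Real.rpow_nonneg hu0.le _) (Finset.sum_nonneg fun j _ => Real.rpow_nonneg hu0.le _)
  have hS : (Fintype.card S : ℝ) = (p : ℝ) ^ Fintype.card ιA := by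
    rw [Fintype.card_congr eS.toEquiv, ← Nat.card_eq_fintype_card, C.card_eq]; push_cast; rfl
  have hprod : ∏ a, F a ≤ (Fintype.card S : ℝ) ^ c := by
    calc ∏ a, F a ≤ ∏ _a : ιA, (p : ℝ) ^ c :=
          Finset.prod_le_prod (fun a _ => hF0 a) fun a _ => hF a
      _ = (Fintype.card S : ℝ) ^ c := by
          rw [Finset.prod_const, Finset.card_univ, hS, ← Real.rpow_natCast ((p : ℝ) ^ c),
            ← Real.rpow_mul hp0.le, mul_comm, Real.rpow_mul hp0.le, Real.rpow_natCast]
  have hprodF : ∏ a, F a = u ^ (-((D : ℝ) / 3)) * ∏ a, ∑ j : Fin p, u ^ (((j : ℕ) : ℝ) * Wr a) := by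
    simp only [F]
    rw [Finset.prod_mul_distrib, ← Real.rpow_sum_of_pos hu0]
    congr 2
    rw [hDr, Finset.mul_sum, Finset.sum_div, ← Finset.sum_neg_distrib]
    refine Finset.sum_congr rfl fun a _ => by ring
  -- lower tail
  have hlow : (Fintype.card {ex : ιA → Fin p // ∑ a, (ex a : ℕ) * C.W a < tt} : ℝ) ≤ ∏ a, F a := by
    have h1 := card_subtype_le_sum_rpow (fun ex : ιA → Fin p => ∑ a, (ex a : ℕ) * C.W a < tt)
      u hu0 (fun ex => -((D : ℝ) / 3) + 1 * ∑ a, ((ex a : ℕ) : ℝ) * Wr a) (fun ex hex => by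
        refine Real.one_le_rpow_of_pos_of_le_one_of_nonpos hu0 hu1 ?_
        have h3 : 3 * ∑ a, (ex a : ℕ) * C.W a ≤ D := by omega
        have h4 : (3 : ℝ) * ∑ a, ((ex a : ℕ) : ℝ) * Wr a ≤ D := by
          show (3 : ℝ) * ∑ a, ((ex a : ℕ) : ℝ) * ((C.W a : ℕ) : ℝ) ≤ D
          exact_mod_cast h3
        linarith)
    refine h1.trans (le_of_eq ?_)
    rw [sum_rpow_weighted p u hu0, hprodF]
    simp only [one_mul]
  -- upper tail
  have hhigh : (Fintype.card {ex : ιA → Fin p // tt + tt ≤ ∑ a, (ex a : ℕ) * C.W a} : ℝ) ≤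
      ∏ a, F a := by
    have h1 := card_subtype_le_sum_rpow
      (fun ex : ιA → Fin p => tt + tt ≤ ∑ a, (ex a : ℕ) * C.W a)
      u hu0 (fun ex => 2 * (D : ℝ) / 3 + (-1) * ∑ a, ((ex a : ℕ) : ℝ) * Wr a) (fun ex hex => by
        refine Real.one_le_rpow_of_pos_of_le_one_of_nonpos hu0 hu1 ?_
        have h3 : 2 * D ≤ 3 * ∑ a, (ex a : ℕ) * C.W a := by omega
        have h4 : (2 : ℝ) * D ≤ 3 * ∑ a, ((ex a : ℕ) : ℝ) * Wr a := by
          show (2 : ℝ) * D ≤ 3 * ∑ a, ((ex a : ℕ) : ℝ) * ((C.W a : ℕ) : ℝ)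
          exact_mod_cast h3
        linarith)
    refine h1.trans (le_of_eq ?_)
    rw [sum_rpow_weighted p u hu0]
    have h2 : ∀ a, ∑ j : Fin p, u ^ (-1 * ((j : ℕ) : ℝ) * Wr a) =
        u ^ (-(((p - 1 : ℕ) : ℝ)) * Wr a) * ∑ j : Fin p, u ^ (((j : ℕ) : ℝ) * Wr a) :=
      fun a => sum_rpow_neg_weighted p u hu0 (Wr a)
    simp_rw [h2]
    rw [Finset.prod_mul_distrib, ← Real.rpow_sum_of_pos hu0, ← mul_assoc, ← Real.rpow_add hu0,
      hprodF]
    congr 2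
    rw [hDr, Finset.mul_sum, Finset.sum_div, Finset.mul_sum, Finset.sum_div,
      ← Finset.sum_add_distrib, ← Finset.sum_neg_distrib]
    refine Finset.sum_congr rfl fun a _ => by ring
  calc (Fintype.card ι : ℝ) ≤ _ := hcard'
    _ ≤ (∏ a, F a) + (∏ a, F a) + ∏ a, F a := by gcongr
    _ = 3 * ∏ a, F a := by ring
    _ ≤ 3 * (Fintype.card S : ℝ) ^ c := by linarith [hprod]

/-- **Exponent-`4` hosts: `|ι| ≤ 3 |S|^{19/20}`** for every twisted matching under any finite family of
automorphism-pair twists (`p = 2`, `E = 2`, `u = 3/4`). [this work] -/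
theorem twistedMatching_card_le_exp_four (S : Type) [CommGroup S] [Fintype S] [DecidableEq S]
    (hexpS : ∀ g : S, g ^ 4 = 1) (σ : Type) [Fintype σ] (φ ψ : σ → S ≃* S) (ι : Type)
    [Fintype ι] (x y z : ι → S)
    (hmatch : ∀ i j l : ι, (∃ s : σ, x i * φ s (y j) * ψ s (z l) = 1) ↔ (i = j ∧ j = l)) :
    (Fintype.card ι : ℝ) ≤ 3 * (Fintype.card S : ℝ) ^ (19 / 20 : ℝ) := by
  haveI : Fact (Nat.Prime 2) := ⟨Nat.prime_two⟩
  refine twistedMatching_card_le_effective_primePow 2 2 (3 / 4) (19 / 20) (by norm_num) (by norm_num)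
    ?_ S (fun g => by simpa using hexpS g) σ φ ψ ι x y z hmatch
  intro s hs
  interval_cases s
  · -- level 0: `θ_2(3/4) = (4/3)^{1/3} · 7/4 ≤ 2^{19/20}`
    rw [Fin.sum_univ_two, Fin.val_zero, Fin.val_one]
    norm_num
    rw [show ((3 : ℝ) / 4) = ((4 : ℝ) / 3)⁻¹ by norm_num, Real.inv_rpow (by norm_num),
      Real.rpow_neg (by norm_num), inv_inv]
    have h60 : (((4 : ℝ) / 3) ^ ((1 : ℝ) / 3) * (7 / 4)) ^ (60 : ℕ) ≤
        ((2 : ℝ) ^ ((19 : ℝ) / 20)) ^ (60 : ℕ) := by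
      rw [mul_pow, ← Real.rpow_natCast (((4 : ℝ) / 3) ^ ((1 : ℝ) / 3)) 60,
        ← Real.rpow_mul (by norm_num), ← Real.rpow_natCast ((2 : ℝ) ^ ((19 : ℝ) / 20)) 60,
        ← Real.rpow_mul (by norm_num),
        show ((1 : ℝ) / 3 * ((60 : ℕ) : ℝ)) = ((20 : ℕ) : ℝ) by norm_num,
        show ((19 : ℝ) / 20 * ((60 : ℕ) : ℝ)) = ((57 : ℕ) : ℝ) by norm_num,
        Real.rpow_natCast, Real.rpow_natCast]
      norm_num
    have := le_of_pow_le_pow_left₀ (by norm_num) (by positivity) h60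
    linarith
  · -- level 1: `θ_2(27/64) = 91/48 ≤ 2^{19/20}`
    rw [Fin.sum_univ_two, Fin.val_zero, Fin.val_one]
    norm_num
    have h20 : ((91 : ℝ) / 48) ^ (20 : ℕ) ≤ ((2 : ℝ) ^ ((19 : ℝ) / 20)) ^ (20 : ℕ) := by
      rw [← Real.rpow_natCast ((2 : ℝ) ^ ((19 : ℝ) / 20)) 20, ← Real.rpow_mul (by norm_num),
        show ((19 : ℝ) / 20 * ((20 : ℕ) : ℝ)) = ((19 : ℕ) : ℝ) by norm_num, Real.rpow_natCast]
      norm_num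
    have := le_of_pow_le_pow_left₀ (by norm_num) (by positivity) h20
    exact this

end EffectivePrimePow

end Summit.MatrixMultiplication.MatrixMultiplication.Theorems.TwistedSliceRank
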